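import Literature.MathematicalPhysics.QuantumLattice.TorusOutwardNeighbours
import Literature.MathematicalPhysics.QuantumLattice.HubbardNNNHoppingInteractionTorus
import HarnessLib

/-!
# The diagonal (next-nearest-neighbour) graph of `(ℤ/Lℤ)²`: bond length, translation invariance,
# and outward bonds between consecutive `ℓ^∞`-shells

Trunk T-QLATTICE (family `hubbard`; consumer: the logarithmic dipole behind the machine-checked
Koma–Tasaki `η`-line of the `t–t'` Hubbard model,
`Summits/HubbardSuperconductivity/HubbardLadder/Bounds/PairCorrelationEtaLineDipoleTPrime.lean`).

The `t'`-hopping of the `t–t'` Hubbard model (`HubbardNNNHopping.hubbardTorusTT'`) lives on the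
diagonal graph `torusDiagGraph L` of the square torus (`x ∼ x ± (e₁+e₂), x ± (e₁-e₂)`). The
general-graph dipole estimate `TorusLogDipoleGraph.logDipole_energy_le_of_graph` needs three facts
about a hopping graph, proved here for the diagonal graph:

* `torusDist_le_one_of_diagAdj` — diagonal bonds have `ℓ^∞`-length `≤ 1`;
* `torusDiagGraph_adj_sub_right_iff` — translation invariance;
* `sum_card_outward_diag_le` — the number of (ordered) diagonal bonds from the shell `‖z‖ = s` to
  the shell `‖w‖ = s+1` is at most `16s + 8 ≤ 16(s+1)` (twice the nearest-neighbour count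
  `8s + 4` of `TorusOutwardNeighbours.sum_card_outward_le`: an outward diagonal bond at `z` leaves
  along a maximal coordinate `i`, `|z_i| = ‖z‖`, with the sign along `i` forced — the cyclic absolute
  value has no strict local minimum with a positive value — and the sign along the other coordinate
  free, whence `≤ 2 #{i : |z_i| = ‖z‖}` outward diagonal bonds at `z`).

Sources: T. Koma, H. Tasaki, PRL 68 (1992) 3248, proof of eq. (13) (P2) and note 9 (finite-range
hopping); H. Xu et al., Science 384 (2024) eadh7691, eq. (1) (the `t–t'` model); S. Friedli,
Y. Velenik, *Statistical Mechanics of Lattice Systems* (CUP 2017), §3.1 (torus geometry).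

## Mathlib search

`Finset.card_image_le`, `Finset.card_product`, `ZMod.val_add`,
`ZMod.val_injective`; the torus norm and the shell combinatorics are the tree's
(`TorusTestPotential`: `torusNorm_two_eq_max`, `val_mem_pair_of_min_eq`, `val_mem_union_of_min_le`,
`min_val_add_one_le`; `HubbardNNNHoppingInteractionTorus.torusDiagGraph_adj_iff`).
-/

namespace Literature.MathematicalPhysics.QuantumLattice

open Finset Literature.Probability.LatticeModels

variable {L : ℕ} [NeZero L]

/-! ### The cyclic absolute value along one coordinate -/

/-- The representative of `a + 1` in `ℤ/Lℤ`. [folklore] -/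
private theorem val_add_one_cases' (a : ZMod L) :
    ((a + 1).val = a.val + 1 ∧ a.val + 1 < L) ∨ ((a + 1).val = 0 ∧ a.val + 1 = L) := by
  have ha : a.val < L := ZMod.val_lt a
  rcases Nat.lt_or_ge 1 L with hL | hL
  · have h1 : (1 : ZMod L).val = 1 := by
      rw [ZMod.val_one_eq_one_mod, Nat.mod_eq_of_lt hL]
    have hv : (a + 1).val = (a.val + 1) % L := by rw [ZMod.val_add, h1]
    rcases Nat.lt_or_ge (a.val + 1) L with hlt | hge
    · left
      rw [hv, Nat.mod_eq_of_lt hlt]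
      exact ⟨rfl, hlt⟩
    · right
      have hEq : a.val + 1 = L := le_antisymm ha hge
      rw [hv, hEq, Nat.mod_self]
      exact ⟨rfl, rfl⟩
  · have hL1 : L = 1 := le_antisymm hL (Nat.one_le_iff_ne_zero.mpr (NeZero.ne L))
    have hb : (a + 1).val < L := ZMod.val_lt _
    right
    omega

/-- The cyclic absolute value has no strict local minimum with a positive value. [folklore] -/
private theorem cyclicAbs_eq_zero_of_strict_local_min' (b : ZMod L)
    (h1 : min (b + 1).val (L - (b + 1).val) < min b.val (L - b.val))
    (h2 : min (b + 1).val (L - (b + 1).val) < min (b + 1 + 1).val (L - (b + 1 + 1).val)) :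
    min (b + 1).val (L - (b + 1).val) = 0 := by
  have hb : b.val < L := ZMod.val_lt b
  have c1 := val_add_one_cases' b
  have c2 := val_add_one_cases' (b + 1)
  omega

/-- Along a step `b = a + 1` or `a = b + 1` the cyclic absolute values differ by at most `1`.
[folklore] -/
private theorem cyclicAbs_step_le' {a b : ZMod L} (h : b = a + 1 ∨ a = b + 1) :
    min b.val (L - b.val) ≤ min a.val (L - a.val) + 1 ∧
      min a.val (L - a.val) ≤ min b.val (L - b.val) + 1 := by
  rcases h with rfl | rfl
  · exact min_val_add_one_le L a
  · exact ⟨(min_val_add_one_le L b).2, (min_val_add_one_le L b).1⟩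

/-! ### The diagonal graph -/

omit [NeZero L] in
/-- The diagonal graph is translation invariant: `u - c ∼ v - c ↔ u ∼ v`.
Friedli–Velenik (2017), §3.1. [cite: FriedliVelenikSMLS2017, §3.1] -/
theorem torusDiagGraph_adj_sub_right_iff (u v c : TorusSite 2 L) :
    (torusDiagGraph L).Adj (u - c) (v - c) ↔ (torusDiagGraph L).Adj u v := by
  simp only [torusDiagGraph_adj_iff, ne_eq, sub_left_inj, sub_add_eq_add_sub]

omit [NeZero L] in
/-- The coordinates of a diagonal jump are `±1`. [folklore] -/
private theorem torusDiagJump_apply (s i : Fin 2) :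
    torusDiagJump L s i = 1 ∨ torusDiagJump L s i = -1 := by
  unfold torusDiagJump
  split_ifs <;> simp

omit [NeZero L] in
/-- Along a diagonal bond EVERY coordinate takes a unit step. Xu et al. (2024), eq. (1)
(`t'` couples `x` to `x ± e₁ ± e₂`). [cite: XuEtAl2024, eq. (1)] -/
theorem coord_step_of_diagAdj {z w : TorusSite 2 L} (h : (torusDiagGraph L).Adj z w) (i : Fin 2) :
    w i = z i + 1 ∨ z i = w i + 1 := by
  rw [torusDiagGraph_adj_iff] at h
  rcases h.2 with ⟨s, hs⟩ | ⟨s, hs⟩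
  · rcases torusDiagJump_apply (L := L) s i with hj | hj
    · left; rw [hs, Pi.add_apply, hj]
    · right; rw [hs, Pi.add_apply, hj]; ring
  · rcases torusDiagJump_apply (L := L) s i with hj | hj
    · right; rw [hs, Pi.add_apply, hj]
    · left; rw [hs, Pi.add_apply, hj]; ring

/-- Along a diagonal bond the torus norms differ by at most `1`. Friedli–Velenik (2017), §3.1.
[cite: FriedliVelenikSMLS2017, §3.1] -/
theorem torusNorm_le_of_diagAdj {z w : TorusSite 2 L} (h : (torusDiagGraph L).Adj z w) :
    torusNorm w ≤ torusNorm z + 1 ∧ torusNorm z ≤ torusNorm w + 1 := by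
  have h0 := cyclicAbs_step_le' (coord_step_of_diagAdj h 0)
  have h1 := cyclicAbs_step_le' (coord_step_of_diagAdj h 1)
  rw [torusNorm_two_eq_max L w, torusNorm_two_eq_max L z]
  constructor
  · exact max_le (by omega) (by omega)
  · exact max_le (by omega) (by omega)

/-- **Diagonal bonds have `ℓ^∞`-length at most one**: `dist(u,v) ≤ 1` for `u ∼ v` in the diagonal
graph. Friedli–Velenik (2017), §3.1. [cite: FriedliVelenikSMLS2017, §3.1] -/
theorem torusDist_le_one_of_diagAdj {u v : TorusSite 2 L} (h : (torusDiagGraph L).Adj u v) :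
    torusDist u v ≤ 1 := by
  have h' : (torusDiagGraph L).Adj (u - v) (v - v) := (torusDiagGraph_adj_sub_right_iff u v v).2 h
  rw [sub_self] at h'
  have h0 : torusNorm (0 : TorusSite 2 L) = 0 := by
    have := torusDist_self (0 : TorusSite 2 L)
    rwa [torusDist, sub_zero] at this
  have := (torusNorm_le_of_diagAdj h').2
  rw [h0] at this
  exact this

/-! ### Outward diagonal bonds at one site -/

omit [NeZero L] in
/-- In `Fin 2`, every index is one of two distinct indices. [folklore] -/
private theorem fin_two_eq_or {i j : Fin 2} (h : j ≠ i) (k : Fin 2) : k = i ∨ k = j := by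
  fin_cases i <;> fin_cases j <;> fin_cases k <;> simp_all

/-- **At most two outward diagonal bonds per maximal coordinate.** For `z ∈ (ℤ/Lℤ)²` with
`‖z‖ ≥ 1`, the number of diagonal neighbours `w` of `z` on the next shell `‖w‖ = ‖z‖ + 1` is at
most `2 #{i : |z_i| = ‖z‖}`: such a `w` has a coordinate `i` with `|w_i| = ‖z‖ + 1`, hence
`|z_i| = ‖z‖`, the sign of the step along `i` is forced (no positive strict local minimum of the
cyclic absolute value) and only the sign along the other coordinate is free. Koma–Tasaki,
PRL 68 (1992) 3248, proof of eq. (13) (P2), note 9. [cite: KomaTasakiPRL1992, proof of eq. (13) (P2) and note 9] -/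
theorem card_outward_diag_le (z : TorusSite 2 L) (hz : 1 ≤ torusNorm z) :
    #{w : TorusSite 2 L | (torusDiagGraph L).Adj z w ∧ torusNorm w = torusNorm z + 1} ≤
      2 * #{i : Fin 2 | min (z i).val (L - (z i).val) = torusNorm z} := by
  classical
  -- forced sign `δ i` along a maximal coordinate, free sign `ε b` along the other one
  let δ : Fin 2 → ZMod L := fun i =>
    if min (z i + 1).val (L - (z i + 1).val) = torusNorm z + 1 then 1 else -1
  let ε : Fin 2 → ZMod L := fun b => if b = 0 then 1 else -1
  let g : Fin 2 × Fin 2 → TorusSite 2 L := fun p j =>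
    if j = p.1 then z j + δ p.1 else z j + ε p.2
  calc #{w : TorusSite 2 L | (torusDiagGraph L).Adj z w ∧ torusNorm w = torusNorm z + 1}
      ≤ #(((univ.filter fun i : Fin 2 => min (z i).val (L - (z i).val) = torusNorm z) ×ˢ
            (univ : Finset (Fin 2))).image g) := by
        refine card_le_card fun w hw => ?_
        simp only [mem_filter, mem_univ, true_and] at hw
        obtain ⟨hadj, hn⟩ := hw
        have hstep := coord_step_of_diagAdj hadj
        -- a coordinate `i` with `|w_i| = ‖z‖ + 1`
        obtain ⟨i, hi⟩ : ∃ i : Fin 2, min (w i).val (L - (w i).val) = torusNorm z + 1 := by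
          rw [torusNorm_two_eq_max] at hn
          rcases le_total (min (w 0).val (L - (w 0).val)) (min (w 1).val (L - (w 1).val))
            with h01 | h01
          · exact ⟨1, by rw [max_eq_right h01] at hn; exact hn⟩
          · exact ⟨0, by rw [max_eq_left h01] at hn; exact hn⟩
        -- it is a maximal coordinate of `z`
        have hzi : min (z i).val (L - (z i).val) = torusNorm z := by
          have hlip := cyclicAbs_step_le' (hstep i)
          have hle : min (z i).val (L - (z i).val) ≤ torusNorm z := by
            rw [torusNorm_two_eq_max]
            fin_cases i
            · exact le_max_left _ _
            · exact le_max_right _ _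
          omega
        -- the other coordinate and its free sign
        obtain ⟨i', hi'⟩ : ∃ i' : Fin 2, i' ≠ i := ⟨i + 1, by fin_cases i <;> decide⟩
        let b : Fin 2 := if w i' = z i' + 1 then 0 else 1
        refine mem_image.2 ⟨(i, b), mem_product.2 ⟨mem_filter.2 ⟨mem_univ _, hzi⟩, mem_univ _⟩, ?_⟩
        funext j
        rcases fin_two_eq_or hi' j with rfl | rfl
        · -- the forced sign along `i`
          simp only [g, if_true]
          rcases hstep j with hw | hw
          · have ht : min (z j + 1).val (L - (z j + 1).val) = torusNorm z + 1 := by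
              rw [← hw]; exact hi
            simp only [δ, if_pos ht, hw]
          · have hf : ¬ min (z j + 1).val (L - (z j + 1).val) = torusNorm z + 1 := by
              intro ht
              -- both `z_j - 1 = w_j` and `z_j + 1` on the outer shell: strict local minimum at `z_j`
              have e1 : z j = w j + 1 := hw
              have k1 : min (w j + 1).val (L - (w j + 1).val) <
                  min (w j).val (L - (w j).val) := by rw [← e1, hzi, hi]; omega
              have k2 : min (w j + 1).val (L - (w j + 1).val) <
                  min (w j + 1 + 1).val (L - (w j + 1 + 1).val) := by
                rw [← e1, hzi, ht]; omega
              have h0 := cyclicAbs_eq_zero_of_strict_local_min' (w j) k1 k2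
              rw [← e1, hzi] at h0
              omega
            simp only [δ, if_neg hf, hw]
            ring
        · -- the free sign along `i'`
          simp only [g, if_neg hi']
          by_cases hb : w j = z j + 1
          · simp only [b, ε, if_pos hb, if_true, hb]
          · have hw : z j = w j + 1 := (hstep j).resolve_left hb
            simp only [b, ε, if_neg hb, show (1 : Fin 2) ≠ 0 by decide, if_false, hw]
            ring
    _ ≤ #((univ.filter fun i : Fin 2 => min (z i).val (L - (z i).val) = torusNorm z) ×ˢ
            (univ : Finset (Fin 2))) := card_image_le
    _ = 2 * #{i : Fin 2 | min (z i).val (L - (z i).val) = torusNorm z} := by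
        rw [card_product, card_univ, Fintype.card_fin, mul_comm]

/-- Every site has at most `4` diagonal neighbours (`z ± (e₁+e₂)`, `z ± (e₁-e₂)`).
Xu et al. (2024), eq. (1). [cite: XuEtAl2024, eq. (1)] -/
theorem card_filter_torusDiagGraph_adj_le (z : TorusSite 2 L) :
    #{w : TorusSite 2 L | (torusDiagGraph L).Adj z w} ≤ 4 := by
  classical
  calc #{w : TorusSite 2 L | (torusDiagGraph L).Adj z w}
      ≤ #((univ : Finset (Fin 2 × Bool)).image fun p =>
          if p.2 then z + torusDiagJump L p.1 else z - torusDiagJump L p.1) := by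
        refine card_le_card fun w hw => ?_
        simp only [mem_filter, mem_univ, true_and] at hw
        rw [torusDiagGraph_adj_iff] at hw
        simp only [mem_image, mem_univ, true_and, Prod.exists]
        rcases hw.2 with ⟨s, hs⟩ | ⟨s, hs⟩
        · exact ⟨s, true, by simp [hs]⟩
        · exact ⟨s, false, by simp [hs]⟩
    _ ≤ #(univ : Finset (Fin 2 × Bool)) := card_image_le
    _ = 4 := by simp

/-! ### The shell sum -/

/-- Sites of the shell `‖z‖ = s` whose `i`-th coordinate is maximal (`|z_i| = s`) inject into
`{s, L-s} × ({0,…,s} ∪ {L-s,…,L-1})` (coordinates `(z_i, z_{i'})`): at most `2(2s+1)` of them.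
[folklore] -/
private theorem card_shell_coord_le (i i' : Fin 2) (hii' : i' ≠ i) (s : ℕ) :
    #{z : TorusSite 2 L | torusNorm z = s ∧ min (z i).val (L - (z i).val) = s} ≤
      2 * (2 * s + 1) := by
  classical
  set T : Finset ℕ := {s, L - s} with hT
  set S : Finset ℕ := range (s + 1) ∪ Ico (L - s) L with hS
  have hTc : #T ≤ 2 := card_insert_le _ _
  have hSc : #S ≤ 2 * s + 1 := by
    calc #S ≤ #(range (s + 1)) + #(Ico (L - s) L) := card_union_le _ _
      _ ≤ 2 * s + 1 := by simp only [card_range, Nat.card_Ico]; omega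
  calc #{z : TorusSite 2 L | torusNorm z = s ∧ min (z i).val (L - (z i).val) = s}
      ≤ #(T ×ˢ S) := by
        refine card_le_card_of_injOn (fun z => ((z i).val, (z i').val)) ?_ ?_
        · intro z hz
          simp only [coe_filter, mem_univ, true_and, Set.mem_setOf_eq] at hz
          obtain ⟨hn, h0⟩ := hz
          have hle : min (z i').val (L - (z i').val) ≤ s := by
            rw [torusNorm_two_eq_max] at hn
            fin_cases i'
            · exact le_of_le_of_eq (le_max_left _ _) hn
            · exact le_of_le_of_eq (le_max_right _ _) hn
          have h0L : (z i).val < L := ZMod.val_lt _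
          have h1L : (z i').val < L := ZMod.val_lt _
          simp only [mem_coe, mem_product]
          exact ⟨val_mem_pair_of_min_eq h0L h0, val_mem_union_of_min_le h1L hle⟩
        · intro z₁ _ z₂ _ h
          simp only [Prod.mk.injEq] at h
          funext k
          rcases fin_two_eq_or hii' k with rfl | rfl
          · exact ZMod.val_injective L h.1
          · exact ZMod.val_injective L h.2
    _ ≤ 2 * (2 * s + 1) := by
        rw [card_product]
        exact Nat.mul_le_mul hTc hSc

/-- On `(ℤ/Lℤ)²` only the origin has torus norm `0`. [folklore] -/
private theorem eq_zero_of_torusNorm_eq_zero' {z : TorusSite 2 L} (h : torusNorm z = 0) :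
    z = 0 := by
  rw [torusNorm_two_eq_max] at h
  have h0 : (z 0).val < L := ZMod.val_lt _
  have h1 : (z 1).val < L := ZMod.val_lt _
  funext i
  fin_cases i
  · show z 0 = 0
    apply ZMod.val_injective L
    rw [ZMod.val_zero]
    omega
  · show z 1 = 0
    apply ZMod.val_injective L
    rw [ZMod.val_zero]
    omega

/-- **Outward diagonal bonds between consecutive `ℓ^∞`-shells of `(ℤ/Lℤ)²`.** For every `s` and
every `L ≥ 1`, the number of (ordered) diagonal bonds `z ∼ w` with `‖z‖ = s`, `‖w‖ = s + 1` is at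
most `16s + 8` (`≤ 2 Σ_{‖z‖=s} #{i : |z_i| = s} ≤ 2 · 2 · 2(2s+1)`; for `s = 0` the bound is the
degree `4`). This is property P2 of the dipole potential for the diagonal (`t'`) bonds in
Koma–Tasaki's proof of their eq. (13), note 9 (finite-range hopping).
[cite: KomaTasakiPRL1992, proof of eq. (13) (P2) and note 9] -/
theorem sum_card_outward_diag_le (s : ℕ) :
    ∑ z ∈ univ.filter (fun z : TorusSite 2 L => torusNorm z = s),
        #{w : TorusSite 2 L | (torusDiagGraph L).Adj z w ∧ torusNorm w = s + 1} ≤ 16 * s + 8 := by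
  classical
  rcases Nat.eq_zero_or_pos s with rfl | hs
  · have hsub : univ.filter (fun z : TorusSite 2 L => torusNorm z = 0) ⊆ {0} := by
      intro z hz
      simp only [mem_filter, mem_univ, true_and] at hz
      rw [mem_singleton]
      exact eq_zero_of_torusNorm_eq_zero' hz
    calc ∑ z ∈ univ.filter (fun z : TorusSite 2 L => torusNorm z = 0),
          #{w : TorusSite 2 L | (torusDiagGraph L).Adj z w ∧ torusNorm w = 0 + 1}
        ≤ ∑ z ∈ ({0} : Finset (TorusSite 2 L)),
            #{w : TorusSite 2 L | (torusDiagGraph L).Adj z w ∧ torusNorm w = 0 + 1} :=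
          sum_le_sum_of_subset hsub
      _ = #{w : TorusSite 2 L | (torusDiagGraph L).Adj 0 w ∧ torusNorm w = 0 + 1} :=
          sum_singleton _ _
      _ ≤ #{w : TorusSite 2 L | (torusDiagGraph L).Adj 0 w} :=
          card_le_card fun w hw => by
            simp only [mem_filter, mem_univ, true_and] at hw ⊢
            exact hw.1
      _ ≤ 4 := card_filter_torusDiagGraph_adj_le 0
      _ = 16 * 0 + 8 - 4 := by norm_num
      _ ≤ 16 * 0 + 8 := Nat.sub_le _ _
  · calc ∑ z ∈ univ.filter (fun z : TorusSite 2 L => torusNorm z = s),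
          #{w : TorusSite 2 L | (torusDiagGraph L).Adj z w ∧ torusNorm w = s + 1}
        ≤ ∑ z ∈ univ.filter (fun z : TorusSite 2 L => torusNorm z = s),
            2 * #{i : Fin 2 | min (z i).val (L - (z i).val) = s} := by
          refine sum_le_sum fun z hz => ?_
          simp only [mem_filter, mem_univ, true_and] at hz
          have h := card_outward_diag_le z (by omega)
          rw [hz] at h
          exact h
      _ = 2 * ∑ z ∈ univ.filter (fun z : TorusSite 2 L => torusNorm z = s),
            ((if min (z 0).val (L - (z 0).val) = s then 1 else 0) +
              (if min (z 1).val (L - (z 1).val) = s then 1 else 0)) := by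
          rw [mul_sum]
          refine sum_congr rfl fun z _ => ?_
          rw [card_filter, Fin.sum_univ_two]
      _ = 2 * (#{z : TorusSite 2 L | torusNorm z = s ∧ min (z 0).val (L - (z 0).val) = s} +
            #{z : TorusSite 2 L | torusNorm z = s ∧ min (z 1).val (L - (z 1).val) = s}) := by
          rw [sum_add_distrib, sum_boole, sum_boole, filter_filter, filter_filter]
          rfl
      _ ≤ 2 * (2 * (2 * s + 1) + 2 * (2 * s + 1)) :=
          Nat.mul_le_mul_left 2 (Nat.add_le_add (card_shell_coord_le 0 1 (by decide) s)
            (card_shell_coord_le 1 0 (by decide) s))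
      _ = 16 * s + 8 := by ring

end Literature.MathematicalPhysics.QuantumLattice
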